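import Mathlib
import HarnessLib
import Summits.HubbardSuperconductivity.HubbardSuperconductivity.Theorems.KLProgrammeMatsubaraSliceBubbleSignBlind

/-!
# Route `KLProgramme` — crux K3, ENGINE child gen 6 (stmt-HubbardSuperconductivity-20236 `KLRegimeEngineV16`), stub `stub_engine_step_values`,
# (E2-v10) ph-loop inputs: ONE-VARIABLE LEMMAS for the β-uniform slice ⊗ soft-partner bubble (`…MatsubaraSoftPartnerSignBlind`)
# (cell gate-hubbard-kl, seat hubbard-kl-k3c2-p2 g7)

§1 `∫_0^T du/(a+u) ≤ 2√T/√a` (`klhs_integral_inv_add_le`), re-centring `∫_{-R}^{R} de/(a+|e−c|) ≤ 4√(2R)/√a` for ANY centre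
(`klhs_integral_inv_add_abs_sub_le`), the zero of a `½`-Lipschitz perturbation of the identity (`klhs_exists_zero_of_half_lipschitz`), and
**`klhs_integral_inv_sqrt_shift_le`**: `∫_{-R}^{R} de/√(ν² + (e+σ(e))²) ≤ 8√2·√R/√|ν|` uniformly in the `½`-Lipschitz shift `σ`.
§2 `Σ_{k<N} 1/√(2k+1) ≤ √(2N)`, antitone rearrangement (`klhs_sum_le_sum_range_of_antitone`), and **`klhs_sum_inv_sqrt_abs_odd_le`**:
`Σ_{i∈I} 1/√|2m_i+1| ≤ 2√(2#I)` for integer labels injective on `I` (the shifted fermionic lattice).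
§3 small tools: the clamp to a window
(`klhs_clamp_lipschitz`, `klhs_clamp_eq_self`), and the soft propagator's norm `‖(d(s′)/s′)(ik₀+e′)‖ ≤ M′/√s′` (`klhs_soft_propagator_norm_le`).

Pure one-variable analysis and finite sums; nothing about the model is asserted; nothing asserts superconductivity.
-/

noncomputable section

namespace Summit.HubbardSuperconductivity.HubbardSuperconductivity.Theorems.KLRegimeSplit

set_option linter.dupNamespace false -- summit = problem name (single-conjunct summit), D-0017

open Real Set MeasureTheory Complex Literature.MathematicalPhysics.QuantumLattice Literature.Probability.LatticeModels
open Summit.HubbardSuperconductivity.HubbardSuperconductivity.Theorems.KLProgrammeLegKernels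

/-! ## §1 One-variable integrals: `∫ du/(a+u)`, re-centring, and the `½`-Lipschitz energy shift -/

/-- **`∫_0^T du/(a+u) ≤ 2√T/√a`** (`a > 0`, `T ≥ 0`): `1/(a+u) ≤ (√a·√(a+u))⁻¹` and `∫_0^T (a+u)^{-1/2} = 2(√(a+T) − √a) ≤ 2√T`. -/
theorem klhs_integral_inv_add_le {a T : ℝ} (ha : 0 < a) (hT : 0 ≤ T) :
    ∫ u in (0:ℝ)..T, 1 / (a + u) ≤ 2 * Real.sqrt T / Real.sqrt a := by
  have hsa : 0 < Real.sqrt a := Real.sqrt_pos.mpr ha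
  have hcont1 : ContinuousOn (fun u : ℝ => 1 / (a + u)) (Set.uIcc 0 T) := by
    refine continuousOn_const.div (continuousOn_const.add continuousOn_id) fun u hu => ?_
    rw [Set.uIcc_of_le hT] at hu
    show a + u ≠ 0
    exact ne_of_gt (by linarith [hu.1])
  have hcont2 : ContinuousOn (fun u : ℝ => (Real.sqrt a)⁻¹ * (Real.sqrt (a + u))⁻¹) (Set.uIcc 0 T) := by
    refine continuousOn_const.mul ((continuousOn_const.add continuousOn_id).sqrt.inv₀ fun u hu => ?_)
    rw [Set.uIcc_of_le hT] at hu
    show Real.sqrt (a + u) ≠ 0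
    exact ne_of_gt (Real.sqrt_pos.mpr (by linarith [hu.1]))
  have hpt : ∀ u ∈ Set.Icc (0:ℝ) T, 1 / (a + u) ≤ (Real.sqrt a)⁻¹ * (Real.sqrt (a + u))⁻¹ := by
    intro u hu
    have hau : 0 < a + u := by linarith [hu.1]
    have h1 : Real.sqrt a * Real.sqrt (a + u) ≤ a + u := by
      calc Real.sqrt a * Real.sqrt (a + u) ≤ Real.sqrt (a + u) * Real.sqrt (a + u) :=
            mul_le_mul_of_nonneg_right (Real.sqrt_le_sqrt (by linarith [hu.1])) (Real.sqrt_nonneg _)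
        _ = a + u := Real.mul_self_sqrt hau.le
    rw [← mul_inv, one_div]
    exact inv_anti₀ (mul_pos hsa (Real.sqrt_pos.mpr hau)) h1
  -- FTC for `u ↦ 2√(a+u)`
  have hderiv : ∀ u ∈ Set.uIcc (0:ℝ) T, HasDerivAt (fun u : ℝ => 2 * Real.sqrt (a + u)) ((Real.sqrt (a + u))⁻¹) u := by
    intro u hu
    rw [Set.uIcc_of_le hT] at hu
    have hau : 0 < a + u := by linarith [hu.1]
    have h : HasDerivAt (fun y : ℝ => 2 * Real.sqrt (a + y)) (2 * (1 / (2 * Real.sqrt (a + u)) * 1)) u :=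
      ((Real.hasDerivAt_sqrt hau.ne').comp u ((hasDerivAt_id' u).const_add a)).const_mul 2
    refine h.congr_deriv ?_
    have hsq : Real.sqrt (a + u) ≠ 0 := ne_of_gt (Real.sqrt_pos.mpr hau)
    field_simp
  have hint : IntervalIntegrable (fun u : ℝ => (Real.sqrt (a + u))⁻¹) volume 0 T := by
    refine ContinuousOn.intervalIntegrable ?_
    refine (continuousOn_const.add continuousOn_id).sqrt.inv₀ fun u hu => ?_
    rw [Set.uIcc_of_le hT] at hu
    show Real.sqrt (a + u) ≠ 0
    exact ne_of_gt (Real.sqrt_pos.mpr (by linarith [hu.1]))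
  have hftc : ∫ u in (0:ℝ)..T, (Real.sqrt (a + u))⁻¹ = 2 * Real.sqrt (a + T) - 2 * Real.sqrt (a + 0) :=
    intervalIntegral.integral_eq_sub_of_hasDerivAt hderiv hint
  calc ∫ u in (0:ℝ)..T, 1 / (a + u) ≤ ∫ u in (0:ℝ)..T, (Real.sqrt a)⁻¹ * (Real.sqrt (a + u))⁻¹ :=
        intervalIntegral.integral_mono_on hT hcont1.intervalIntegrable hcont2.intervalIntegrable hpt
    _ = (Real.sqrt a)⁻¹ * (2 * Real.sqrt (a + T) - 2 * Real.sqrt a) := by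
        rw [intervalIntegral.integral_const_mul, hftc, add_zero]
    _ ≤ (Real.sqrt a)⁻¹ * (2 * Real.sqrt T) := by
        refine mul_le_mul_of_nonneg_left ?_ (inv_nonneg.mpr hsa.le)
        -- `√(a+T) ≤ √a + √T` (the tree's `MRT2015.sqrt_add_le_sqrt_add_sqrt`; two lines inline rather than a number-theory import)
        have hsq : Real.sqrt (a + T) ≤ Real.sqrt a + Real.sqrt T := by
          rw [Real.sqrt_le_left (by positivity)]
          nlinarith [Real.sq_sqrt ha.le, Real.sq_sqrt hT, Real.sqrt_nonneg a, Real.sqrt_nonneg T]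
        linarith
    _ = 2 * Real.sqrt T / Real.sqrt a := by rw [div_eq_inv_mul]

/-- **Re-centring**: `∫_{-R}^{R} de/(a + |e − c|) ≤ 4√(2R)/√a` for `a > 0`, `R ≥ 0` and ANY centre `c` (split at the clamp of `c` to `[−R, R]`;
each half is `≤ ∫_0^{2R} du/(a+u)`). -/
theorem klhs_integral_inv_add_abs_sub_le {a R : ℝ} (ha : 0 < a) (hR : 0 ≤ R) (c : ℝ) :
    ∫ e in (-R)..R, 1 / (a + |e - c|) ≤ 4 * Real.sqrt (2 * R) / Real.sqrt a := by
  set c' := max (-R) (min c R) with hc'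
  have hc'lo : -R ≤ c' := le_max_left _ _
  have hc'hi : c' ≤ R := max_le (by linarith) (min_le_right _ _)
  have hf_cont : Continuous fun e : ℝ => 1 / (a + |e - c|) := by
    refine continuous_const.div (continuous_const.add ((continuous_id.sub continuous_const).abs)) fun e => ?_
    have := abs_nonneg (e - c); exact ne_of_gt (by linarith)
  have hint : ∀ x y : ℝ, IntervalIntegrable (fun e : ℝ => 1 / (a + |e - c|)) volume x y :=
    fun x y => hf_cont.intervalIntegrable _ _
  have hsa : 0 < Real.sqrt a := Real.sqrt_pos.mpr ha
  -- right half
  have hright : ∫ e in c'..R, 1 / (a + |e - c|) ≤ 2 * Real.sqrt (2 * R) / Real.sqrt a := by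
    have hpt : ∀ e ∈ Set.Icc c' R, 1 / (a + |e - c|) ≤ 1 / (a + (e - c')) := by
      intro e he
      have hle : e - c' ≤ |e - c| := by
        rcases le_or_gt c R with hcR | hcR
        · have : c ≤ c' := by rw [hc', min_eq_left hcR]; exact le_max_right _ _
          exact le_trans (by linarith) (le_abs_self _)
        · have : c' = R := by rw [hc', min_eq_right hcR.le, max_eq_right (by linarith)]
          linarith [abs_nonneg (e - c), he.2]
      exact one_div_le_one_div_of_le (by linarith [he.1]) (by linarith)
    have hcont : ContinuousOn (fun e : ℝ => 1 / (a + (e - c'))) (Set.uIcc c' R) := by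
      refine continuousOn_const.div (continuousOn_const.add (continuousOn_id.sub continuousOn_const)) fun e he => ?_
      rw [Set.uIcc_of_le hc'hi] at he
      exact ne_of_gt (by linarith [he.1])
    calc ∫ e in c'..R, 1 / (a + |e - c|) ≤ ∫ e in c'..R, 1 / (a + (e - c')) :=
          intervalIntegral.integral_mono_on hc'hi (hint _ _) hcont.intervalIntegrable hpt
      _ = ∫ u in (c' - c')..(R - c'), 1 / (a + u) :=
          intervalIntegral.integral_comp_sub_right (fun u : ℝ => 1 / (a + u)) c'
      _ = ∫ u in (0:ℝ)..(R - c'), 1 / (a + u) := by rw [sub_self]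
      _ ≤ 2 * Real.sqrt (R - c') / Real.sqrt a := klhs_integral_inv_add_le ha (by linarith)
      _ ≤ 2 * Real.sqrt (2 * R) / Real.sqrt a := by gcongr; linarith
  -- left half
  have hleft : ∫ e in (-R)..c', 1 / (a + |e - c|) ≤ 2 * Real.sqrt (2 * R) / Real.sqrt a := by
    have hpt : ∀ e ∈ Set.Icc (-R) c', 1 / (a + |e - c|) ≤ 1 / (a + (c' - e)) := by
      intro e he
      have hle : c' - e ≤ |e - c| := by
        rcases le_or_gt (-R) c with hcR | hcR
        · have : c' ≤ c := by
            rw [hc']; exact max_le hcR (min_le_left _ _)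
          rw [abs_sub_comm]
          exact le_trans (by linarith) (le_abs_self _)
        · have : c' = -R := by
            rw [hc', min_eq_left (by linarith : c ≤ R), max_eq_left hcR.le]
          linarith [abs_nonneg (e - c), he.1]
      exact one_div_le_one_div_of_le (by linarith [he.2]) (by linarith)
    have hcont : ContinuousOn (fun e : ℝ => 1 / (a + (c' - e))) (Set.uIcc (-R) c') := by
      refine continuousOn_const.div (continuousOn_const.add (continuousOn_const.sub continuousOn_id)) fun e he => ?_
      rw [Set.uIcc_of_le hc'lo] at he
      exact ne_of_gt (by linarith [he.2])
    calc ∫ e in (-R)..c', 1 / (a + |e - c|) ≤ ∫ e in (-R)..c', 1 / (a + (c' - e)) :=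
          intervalIntegral.integral_mono_on hc'lo (hint _ _) hcont.intervalIntegrable hpt
      _ = ∫ u in (c' - c')..(c' - -R), 1 / (a + u) :=
          intervalIntegral.integral_comp_sub_left (fun u : ℝ => 1 / (a + u)) c'
      _ = ∫ u in (0:ℝ)..(c' + R), 1 / (a + u) := by rw [sub_self, sub_neg_eq_add]
      _ ≤ 2 * Real.sqrt (c' + R) / Real.sqrt a := klhs_integral_inv_add_le ha (by linarith)
      _ ≤ 2 * Real.sqrt (2 * R) / Real.sqrt a := by gcongr; linarith
  rw [← intervalIntegral.integral_add_adjacent_intervals (hint (-R) c') (hint c' R)]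
  calc (∫ e in (-R)..c', 1 / (a + |e - c|)) + ∫ e in c'..R, 1 / (a + |e - c|)
      ≤ 2 * Real.sqrt (2 * R) / Real.sqrt a + 2 * Real.sqrt (2 * R) / Real.sqrt a := add_le_add hleft hright
    _ = 4 * Real.sqrt (2 * R) / Real.sqrt a := by ring

/-- **A `½`-Lipschitz perturbation of the identity has a zero and is `½`-co-Lipschitz about it**: `|σ(e) − σ(e′)| ≤ |e − e′|/2` for all
`e, e′` ⇒ `∃ z, z + σ(z) = 0 ∧ ∀ e, |e − z|/2 ≤ |e + σ(e)|`. -/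
theorem klhs_exists_zero_of_half_lipschitz {σ : ℝ → ℝ} (hσ : ∀ e e', |σ e - σ e'| ≤ |e - e'| / 2) :
    ∃ z : ℝ, z + σ z = 0 ∧ ∀ e, |e - z| / 2 ≤ |e + σ e| := by
  have hσc : Continuous σ := by
    refine Metric.continuous_iff.mpr fun e ε hε => ⟨ε, hε, fun e' he' => ?_⟩
    rw [Real.dist_eq] at he' ⊢
    linarith [hσ e' e, abs_nonneg (e' - e)]
  have hcont : Continuous fun e : ℝ => e + σ e := continuous_id.add hσc
  set b : ℝ := 2 * |σ 0| with hb
  have hb0 : 0 ≤ b := by positivity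
  have hlo : (-b) + σ (-b) ≤ 0 := by
    have h := hσ (-b) 0
    rw [sub_zero, abs_neg, abs_of_nonneg hb0] at h
    have h2 : σ (-b) ≤ σ 0 + b / 2 := by linarith [le_abs_self (σ (-b) - σ 0)]
    linarith [le_abs_self (σ 0)]
  have hhi : 0 ≤ b + σ b := by
    have h := hσ b 0
    rw [sub_zero, abs_of_nonneg hb0] at h
    have h2 : σ 0 - b / 2 ≤ σ b := by linarith [neg_abs_le (σ b - σ 0)]
    linarith [neg_abs_le (σ 0)]
  have hmem : (0 : ℝ) ∈ Set.Icc ((-b) + σ (-b)) (b + σ b) := ⟨hlo, hhi⟩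
  obtain ⟨z, _, hz⟩ := intermediate_value_Icc (by linarith : -b ≤ b) hcont.continuousOn hmem
  refine ⟨z, hz, fun e => ?_⟩
  have h1 : |e + σ e| = |(e - z) + (σ e - σ z)| := by
    congr 1; linarith
  rw [h1]
  have h2 := hσ e z
  have h3 := abs_sub_abs_le_abs_sub (e - z) (-(σ e - σ z))
  rw [sub_neg_eq_add, abs_neg] at h3
  linarith

/-- `1/√(ν² + x²) ≤ √2/(|ν| + |x|)` for `ν ≠ 0`. -/
theorem klhs_inv_sqrt_sq_add_sq_le {ν : ℝ} (hν : ν ≠ 0) (x : ℝ) :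
    1 / Real.sqrt (ν ^ 2 + x ^ 2) ≤ Real.sqrt 2 / (|ν| + |x|) := by
  have hνa : 0 < |ν| := abs_pos.mpr hν
  have hpos : 0 < |ν| + |x| := by positivity
  have hs : 0 < Real.sqrt (ν ^ 2 + x ^ 2) := Real.sqrt_pos.mpr (by positivity)
  -- `|ν| + |x| ≤ √2 · √(ν²+x²) = √(2(ν²+x²))`
  have key : |ν| + |x| ≤ Real.sqrt 2 * Real.sqrt (ν ^ 2 + x ^ 2) := by
    rw [← Real.sqrt_mul (by norm_num : (0:ℝ) ≤ 2)]
    refine Real.le_sqrt_of_sq_le ?_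
    nlinarith [sq_abs ν, sq_abs x, sq_nonneg (|ν| - |x|)]
  rw [div_le_div_iff₀ hs hpos, one_mul]
  exact key

/-- **The `e`-integral against a shifted soft propagator**: for `ν ≠ 0`, `R ≥ 0` and a `½`-Lipschitz energy shift `σ`,
`∫_{-R}^{R} de/√(ν² + (e + σ(e))²) ≤ 8√2·√R/√|ν|` — uniformly in `σ` (in particular in `σ(0)`, the shift at the Fermi point). -/
theorem klhs_integral_inv_sqrt_shift_le {ν R : ℝ} (hν : ν ≠ 0) (hR : 0 ≤ R) {σ : ℝ → ℝ} (hσ : ∀ e e', |σ e - σ e'| ≤ |e - e'| / 2) :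
    ∫ e in (-R)..R, 1 / Real.sqrt (ν ^ 2 + (e + σ e) ^ 2) ≤ 8 * Real.sqrt 2 * Real.sqrt R / Real.sqrt |ν| := by
  obtain ⟨z, -, hz⟩ := klhs_exists_zero_of_half_lipschitz hσ
  have hνa : 0 < |ν| := abs_pos.mpr hν
  have ha : 0 < 2 * |ν| := by positivity
  have hσc : Continuous σ := by
    refine Metric.continuous_iff.mpr fun e ε hε => ⟨ε, hε, fun e' he' => ?_⟩
    rw [Real.dist_eq] at he' ⊢
    linarith [hσ e' e, abs_nonneg (e' - e)]
  -- pointwise: `1/√(ν²+(e+σe)²) ≤ √2/(|ν| + |e+σe|) ≤ √2/(|ν| + |e−z|/2) = 2√2·(1/(2|ν| + |e − z|))`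
  have hpt : ∀ e ∈ Set.Icc (-R) R, 1 / Real.sqrt (ν ^ 2 + (e + σ e) ^ 2) ≤ 2 * Real.sqrt 2 * (1 / (2 * |ν| + |e - z|)) := by
    intro e _
    refine (klhs_inv_sqrt_sq_add_sq_le hν (e + σ e)).trans ?_
    have h1 : 0 < |ν| + |e - z| / 2 := by positivity
    calc Real.sqrt 2 / (|ν| + |e + σ e|) ≤ Real.sqrt 2 / (|ν| + |e - z| / 2) :=
          div_le_div_of_nonneg_left (Real.sqrt_nonneg 2) h1 (by linarith [hz e])
      _ = 2 * Real.sqrt 2 * (1 / (2 * |ν| + |e - z|)) := by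
          rw [show |ν| + |e - z| / 2 = (2 * |ν| + |e - z|) / 2 by ring, div_div_eq_mul_div]
          ring
  have hcontL : ContinuousOn (fun e : ℝ => 1 / Real.sqrt (ν ^ 2 + (e + σ e) ^ 2)) (Set.uIcc (-R) R) := by
    refine (continuousOn_const.div ((continuousOn_const.add ((continuousOn_id.add hσc.continuousOn).pow 2)).sqrt) fun e _ => ?_)
    exact ne_of_gt (Real.sqrt_pos.mpr (by positivity))
  have hcontR : Continuous (fun e : ℝ => 2 * Real.sqrt 2 * (1 / (2 * |ν| + |e - z|))) := by
    refine continuous_const.mul (continuous_const.div (continuous_const.add ((continuous_id.sub continuous_const).abs)) fun e => ?_)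
    have := abs_nonneg (e - z); exact ne_of_gt (by linarith)
  calc ∫ e in (-R)..R, 1 / Real.sqrt (ν ^ 2 + (e + σ e) ^ 2)
      ≤ ∫ e in (-R)..R, 2 * Real.sqrt 2 * (1 / (2 * |ν| + |e - z|)) :=
        intervalIntegral.integral_mono_on (by linarith) hcontL.intervalIntegrable (hcontR.intervalIntegrable _ _) hpt
    _ = 2 * Real.sqrt 2 * ∫ e in (-R)..R, 1 / (2 * |ν| + |e - z|) := intervalIntegral.integral_const_mul _ _
    _ ≤ 2 * Real.sqrt 2 * (4 * Real.sqrt (2 * R) / Real.sqrt (2 * |ν|)) :=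
        mul_le_mul_of_nonneg_left (klhs_integral_inv_add_abs_sub_le ha hR z) (by positivity)
    _ = 8 * Real.sqrt 2 * Real.sqrt R / Real.sqrt |ν| := by
        rw [Real.sqrt_mul (by norm_num : (0:ℝ) ≤ 2) R, Real.sqrt_mul (by norm_num : (0:ℝ) ≤ 2) |ν|]
        have h2 : Real.sqrt 2 ≠ 0 := by positivity
        field_simp
        ring

/-! ## §2 Sums of `1/√(odd)` over injectively labelled finite sets -/

/-- `Σ_{k<N} 1/√(2k+1) ≤ √(2N)` (`√(2N) + √(2N+2) ≤ 2√(2N+1)`, concavity). -/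
theorem klhs_sum_inv_sqrt_odd_le (N : ℕ) : ∑ k ∈ Finset.range N, 1 / Real.sqrt (2 * k + 1) ≤ Real.sqrt (2 * N) := by
  induction N with
  | zero => simp
  | succ N ih =>
    rw [Finset.sum_range_succ]
    have hN : (0:ℝ) ≤ N := Nat.cast_nonneg N
    set A := Real.sqrt (2 * N) with hA
    set B := Real.sqrt (2 * (N + 1 : ℕ)) with hB
    set C := Real.sqrt (2 * N + 1) with hC
    have hB' : B = Real.sqrt (2 * N + 2) := by rw [hB]; push_cast; ring_nf
    have hA0 : 0 ≤ A := Real.sqrt_nonneg _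
    have hB0 : 0 < B := by rw [hB']; positivity
    have hC0 : 0 < C := by positivity
    have hA2 : A ^ 2 = 2 * N := Real.sq_sqrt (by positivity)
    have hB2 : B ^ 2 = 2 * N + 2 := by rw [hB']; exact Real.sq_sqrt (by positivity)
    have hC2 : C ^ 2 = 2 * N + 1 := Real.sq_sqrt (by positivity)
    -- `A·B ≤ 2N+1`
    have hAB : A * B ≤ 2 * N + 1 := by
      rw [hB', hA, ← Real.sqrt_mul (by positivity)]
      calc Real.sqrt (2 * N * (2 * N + 2)) ≤ Real.sqrt ((2 * N + 1) ^ 2) := Real.sqrt_le_sqrt (by nlinarith)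
        _ = 2 * N + 1 := Real.sqrt_sq (by positivity)
    -- `A + B ≤ 2C`
    have hsum : A + B ≤ 2 * C := by
      have h : (A + B) ^ 2 ≤ (2 * C) ^ 2 := by nlinarith
      exact le_of_sq_le_sq h (by positivity) |> fun h' => by
        exact (pow_le_pow_iff_left₀ (by positivity) (by positivity) two_ne_zero).mp h
    -- `B − A = 2/(A+B) ≥ 1/C`
    have hdiff : 1 / C ≤ B - A := by
      have hprod : (B - A) * (B + A) = 2 := by nlinarith
      have hBA : 0 < B + A := by positivity
      rw [div_le_iff₀ hC0]
      nlinarith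
    calc ∑ k ∈ Finset.range N, 1 / Real.sqrt (2 * k + 1) + 1 / Real.sqrt (2 * (N : ℕ) + 1) ≤ A + 1 / C := by
          exact add_le_add ih le_rfl
      _ ≤ B := by linarith

/-- **Antitone rearrangement**: for an antitone `ψ : ℕ → ℝ`, the sum over ANY finite set of naturals is at most the sum over the initial
segment of the same size. -/
theorem klhs_sum_le_sum_range_of_antitone {ψ : ℕ → ℝ} (hψ : Antitone ψ) (S : Finset ℕ) :
    ∑ k ∈ S, ψ k ≤ ∑ k ∈ Finset.range S.card, ψ k := by
  induction S using Finset.induction_on_max with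
  | empty => simp
  | insert m S hlt ih =>
    have hm : m ∉ S := fun h => lt_irrefl m (hlt m h)
    rw [Finset.sum_insert hm, Finset.card_insert_of_notMem hm, Finset.sum_range_succ]
    have hcard : S.card ≤ m := by
      calc S.card ≤ (Finset.range m).card := Finset.card_le_card fun x hx => Finset.mem_range.mpr (hlt x hx)
        _ = m := Finset.card_range m
    linarith [hψ hcard]

/-- `k ↦ 1/√(2k+1)` is antitone on `ℕ`. -/
theorem klhs_antitone_inv_sqrt_odd : Antitone fun k : ℕ => 1 / Real.sqrt (2 * k + 1) := by
  intro a b hab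
  exact one_div_le_one_div_of_le (Real.sqrt_pos.mpr (by positivity))
    (Real.sqrt_le_sqrt (by exact_mod_cast (by omega : 2 * a + 1 ≤ 2 * b + 1)))

/-- For naturals: `Σ_{i∈I} 1/√(2k_i+1) ≤ √(2#I)` when `k` is injective on `I`. -/
theorem klhs_sum_inv_sqrt_odd_le_of_injOn {ι : Type*} (I : Finset ι) (k : ι → ℕ) (hk : Set.InjOn k I) :
    ∑ i ∈ I, 1 / Real.sqrt (2 * (k i : ℝ) + 1) ≤ Real.sqrt (2 * I.card) := by
  classical
  rw [← Finset.sum_image (f := fun j : ℕ => 1 / Real.sqrt (2 * (j : ℝ) + 1)) hk]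
  refine (klhs_sum_le_sum_range_of_antitone klhs_antitone_inv_sqrt_odd _).trans ?_
  rw [Finset.card_image_of_injOn hk]
  exact klhs_sum_inv_sqrt_odd_le _

/-- **`Σ_{i∈I} 1/√|2m_i+1| ≤ 2√(2#I)`** for integer labels `m` injective on `I` (split by the sign of `m_i`; `|2m+1| = 2k+1` with `k = m` resp.
`k = −m−1`). -/
theorem klhs_sum_inv_sqrt_abs_odd_le {ι : Type*} (I : Finset ι) (m : ι → ℤ) (hm : Set.InjOn m I) :
    ∑ i ∈ I, 1 / Real.sqrt |2 * (m i : ℝ) + 1| ≤ 2 * Real.sqrt (2 * I.card) := by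
  classical
  set Ip := I.filter fun i => 0 ≤ m i with hIp
  set In := I.filter fun i => ¬ 0 ≤ m i with hIn
  have hsplit := Finset.sum_filter_add_sum_filter_not I (fun i => 0 ≤ m i) (fun i => 1 / Real.sqrt |2 * (m i : ℝ) + 1|)
  rw [← hsplit]
  have hcardp : (Ip.card : ℝ) ≤ I.card := by exact_mod_cast Finset.card_filter_le _ _
  have hcardn : (In.card : ℝ) ≤ I.card := by exact_mod_cast Finset.card_filter_le _ _
  -- nonnegative labels
  have hp : ∑ i ∈ Ip, 1 / Real.sqrt |2 * (m i : ℝ) + 1| ≤ Real.sqrt (2 * I.card) := by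
    have heq : ∀ i ∈ Ip, 1 / Real.sqrt |2 * (m i : ℝ) + 1| = 1 / Real.sqrt (2 * ((m i).toNat : ℝ) + 1) := by
      intro i hi
      have h0 : 0 ≤ m i := (Finset.mem_filter.mp hi).2
      have h1 : ((m i).toNat : ℝ) = (m i : ℝ) := by exact_mod_cast Int.toNat_of_nonneg h0
      rw [h1, abs_of_nonneg]
      have : (0:ℝ) ≤ (m i : ℝ) := by exact_mod_cast h0
      linarith
    rw [Finset.sum_congr rfl heq]
    have hinj : Set.InjOn (fun i => (m i).toNat) Ip := by
      intro i hi j hj hij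
      have hi0 : 0 ≤ m i := (Finset.mem_filter.mp (Finset.mem_coe.mp hi)).2
      have hj0 : 0 ≤ m j := (Finset.mem_filter.mp (Finset.mem_coe.mp hj)).2
      have : m i = m j := by
        have := congrArg (fun n : ℕ => (n : ℤ)) hij
        simpa [Int.toNat_of_nonneg hi0, Int.toNat_of_nonneg hj0] using this
      exact hm (Finset.mem_filter.mp (Finset.mem_coe.mp hi)).1 (Finset.mem_filter.mp (Finset.mem_coe.mp hj)).1 this
    exact (klhs_sum_inv_sqrt_odd_le_of_injOn Ip _ hinj).trans (Real.sqrt_le_sqrt (by linarith))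
  -- negative labels
  have hn : ∑ i ∈ In, 1 / Real.sqrt |2 * (m i : ℝ) + 1| ≤ Real.sqrt (2 * I.card) := by
    have heq : ∀ i ∈ In, 1 / Real.sqrt |2 * (m i : ℝ) + 1| = 1 / Real.sqrt (2 * ((-m i - 1).toNat : ℝ) + 1) := by
      intro i hi
      have h0 : m i < 0 := not_le.mp (Finset.mem_filter.mp hi).2
      have h0' : 0 ≤ -m i - 1 := by omega
      have h1 : ((-m i - 1).toNat : ℝ) = ((-m i - 1 : ℤ) : ℝ) := by exact_mod_cast Int.toNat_of_nonneg h0'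
      rw [h1, abs_of_neg]
      · push_cast; ring
      · have : (m i : ℝ) ≤ -1 := by exact_mod_cast (show m i ≤ -1 by omega)
        linarith
    rw [Finset.sum_congr rfl heq]
    have hinj : Set.InjOn (fun i => (-m i - 1).toNat) In := by
      intro i hi j hj hij
      have hi0 : m i < 0 := not_le.mp (Finset.mem_filter.mp (Finset.mem_coe.mp hi)).2
      have hj0 : m j < 0 := not_le.mp (Finset.mem_filter.mp (Finset.mem_coe.mp hj)).2
      have : m i = m j := by
        have := congrArg (fun n : ℕ => (n : ℤ)) hij
        simp only [Int.toNat_of_nonneg (show 0 ≤ -m i - 1 by omega), Int.toNat_of_nonneg (show 0 ≤ -m j - 1 by omega)] at this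
        omega
      exact hm (Finset.mem_filter.mp (Finset.mem_coe.mp hi)).1 (Finset.mem_filter.mp (Finset.mem_coe.mp hj)).1 this
    exact (klhs_sum_inv_sqrt_odd_le_of_injOn In _ hinj).trans (Real.sqrt_le_sqrt (by linarith))
  linarith

/-! ## §3 Small tools: clamp, soft propagator norm -/


/-- The clamp to `[−R, R]` is `1`-Lipschitz. -/
theorem klhs_clamp_lipschitz (R e e' : ℝ) : |max (-R) (min e R) - max (-R) (min e' R)| ≤ |e - e'| := by
  have h1 := abs_max_sub_max_le_max (-R) (min e R) (-R) (min e' R)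
  have h2 := abs_min_sub_min_le_max e R e' R
  rw [sub_self, abs_zero] at h1 h2
  have h3 : max |e - e'| 0 = |e - e'| := max_eq_left (abs_nonneg _)
  rw [h3] at h2
  calc |max (-R) (min e R) - max (-R) (min e' R)| ≤ max 0 |min e R - min e' R| := h1
    _ ≤ |e - e'| := max_le (abs_nonneg _) h2

/-- The clamp is the identity on the open window. -/
theorem klhs_clamp_eq_self {R e : ℝ} (he : |e| < R) : max (-R) (min e R) = e := by
  rw [abs_lt] at he
  rw [min_eq_left he.2.le, max_eq_right he.1.le]


section Soft

/-- **The soft propagator meets the partner hypothesis**: for a soft weight `d` with `‖d(s)‖ ≤ M′` (e.g. `1 − χ`, `M′ = 1`), at every frequency `k₀ ≠ 0`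
and energy `e′`, `‖(d(s′)/s′)·(ik₀ + e′)‖ ≤ M′/√(k₀² + e′²)`, `s′ = k₀² + e′²`. -/
theorem klhs_soft_propagator_norm_le {d : ℝ → ℂ} {M' : ℝ} (hd : ∀ s, ‖d s‖ ≤ M') {k₀ : ℝ} (hk : k₀ ≠ 0) (e' : ℝ) :
    ‖d (k₀ ^ 2 + e' ^ 2) / (((k₀ ^ 2 + e' ^ 2 : ℝ)) : ℂ) * (I * k₀ + e')‖ ≤ M' / Real.sqrt (k₀ ^ 2 + e' ^ 2) := by
  set s : ℝ := k₀ ^ 2 + e' ^ 2 with hsdef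
  have hs : 0 < s := by positivity
  have ht : 0 < Real.sqrt s := Real.sqrt_pos.mpr hs
  rw [norm_mul, norm_div, Complex.norm_real, Real.norm_of_nonneg hs.le, klzd_norm_lin, ← hsdef,
    div_mul_eq_mul_div, mul_div_assoc, Real.sqrt_div_self', mul_one_div]
  exact div_le_div_of_nonneg_right (hd _) ht.le

end Soft

end Summit.HubbardSuperconductivity.HubbardSuperconductivity.Theorems.KLRegimeSplit

end
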